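import Summits.BirchSwinnertonDyer.BirchSwinnertonDyer.Theorems.QuadraticBranchSignedControlPlusEtaNonsurjPlusCoeffCongruenceReadings
import Summits.BirchSwinnertonDyer.BirchSwinnertonDyer.Theorems.QuadraticBranchSignedControlPlusEtaNonsurjConjADoorBSDRecordsR1Sd
import Summits.BirchSwinnertonDyer.BirchSwinnertonDyer.Theorems.QuadraticBranchSignedControlPlusEtaNonsurjConjADoorBSDRecordsR1Se
import HarnessLib

/-!
# Route `QuadraticBranchSignedControl` (rung K8, cell `bsd-potss`), residual crux `PlusEtaMainConjectureNonsurj`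
# (stmt-BirchSwinnertonDyer-19606): `BSD_5` RECORDS R1SS(e) — `MissingPPartAt W 5` on `λ⁻ = 3` rank-one rows with BOTH analytic inputs READ OFF
# MODULAR SYMBOLS: `hX` «(L_5⁺(V,η,X)) = (X)» from `v₅(ϖ·coeff₁θ₂(η)) = 1` and (N1′) «v₅(coeff₁L_5⁻(V,η,X)) = 1» from `v₅(ϖ·coeff₁θ₃(η)) = 2`
# (θ-coefficient congruences `…{Minus,Plus}CoeffCongruence{,Readings}`, seat `bsd-potss-k8eta-c2` g24)

WHAT. For each row the lineage holds `missingPPartAt_r1k_<row>_5_of_<door>` (g22/g23: hX from PARI `(λ⁺,μ⁺) = (1,0)`, (N1′) from a `5`-adic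
`L`-series / MT-C1 measurement) and `missingPPartAt_r1s_<row>_5_of_<door>` (g24: (N1′) from symbols). The records of THIS file display NO `p`-adic
`L`-function numerics at all: the plus-side shape `hX` is PRODUCED in the kernel (`EtaPlusCoeffCongruence.span_eq_span_X_of_mazurTate_padicValRat`:
`L_5⁺(V,η,0) = 0` from `r_an(W) = 1`, EtaPrimeRoad + Kobayashi (3.6) + Birch; `coeff₁` a unit from the level-`2` congruence) from the displayed valuation
`1` of the rational `ϖ·coeff₁θ₂(η)` (`θ₂(η) = quadraticBranchMazurTateElement 5 f 2`), and (N1′) from the displayed valuation `2` of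
`ϖ·coeff₁θ₃(η)` as in R1S. NUMBERS (kit j336272, g23's engine MT-C1 with stage 2 extended to all levels `n ≤ 3`, `p = 5`; pre-registered P-24C on
STATUS, 23/23 as registered): rows of this part c5c_17 (`Σ u·TH₂[u] = 280`, `v₅ = 1` ⟹ `hX`; `Σ u·TH₃[u] = -3100`, `v₅ = 2` ⟹ (N1′)); c5e_17 (`Σ u·TH₂[u] = 7060`, `v₅ = 1` ⟹ `hX`; `Σ u·TH₃[u] = -9900`, `v₅ = 2` ⟹ (N1′)); c5f_8 (`Σ u·TH₂[u] = -330`, `v₅ = 1` ⟹ `hX`; `Σ u·TH₃[u] = -1650`, `v₅ = 2` ⟹ (N1′)). Everything else (row, door datum, named facts `hGZK hmod hnf hM h12 hKO hGZ h74 h22 h41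
h6273`, (N2′), (N3′)) is VERBATIM the r1k/r1s record.

HONEST FRAMING (cell `bsd-potss`; FULL-BSD rank ≤ 1 programme, HUMAN RULING D-0036/D-0074): per-row RECORDS, CONDITIONAL on the named facts and on
displayed per-row data; the two symbol valuations are numerical data (exact rational arithmetic on numerically recovered symbols), evidence not kernel
facts; `BSD(W,5)` ASSERTED for no pair; C-cc-1 NOT proved; no stub of 19606 proved; crux and route OPEN; nothing booked. `--supports stmt-BirchSwinnertonDyer-19606`.

References: [Kobayashi2003] Thm. 1.2, 2.2, 3.2, (3.4)–(3.7), §4, Thm. 4.1, 6.2–7.4, 9.3; [Kobayashi2013]; [Pollack2003] Prop. 6.18; [Mazur1978] Cor. 4.1;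
[KitajimaOtsuki2018] Main Thm. 1.3; [GrossZagier1986] I (7.3); [Miller2011LMS] Def. 1.1; [Cremona1997] Table 1.
-/

set_option autoImplicit false
set_option linter.dupNamespace false
noncomputable section

open scoped Classical nonZeroDivisors

open CongruenceSubgroup NumberField Field WeierstrassCurve
open Literature.NumberTheory.EllipticCurves Literature.NumberTheory.EllipticCurves.ModularForms
  Literature.NumberTheory.EllipticCurves.Rank1Residual Literature.NumberTheory.EllipticCurves.Rank1Residual.Typed
  Literature.NumberTheory.GaloisRepresentations Literature.NumberTheory.GaloisCohomology Literature.NumberTheory.NumberFields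
  Literature.NumberTheory.EllipticCurves.GreenbergVatsal2000 ZpExtension
open Summit.BirchSwinnertonDyer.Rank1Residual Summit.BirchSwinnertonDyer.Rank1Residual.Additive
open Summit.BirchSwinnertonDyer.Rank1Residual.X11b (isElliptic_of_discOf_ne_zero)
open Summit.BirchSwinnertonDyer.BirchSwinnertonDyer.Theorems

namespace Summit.BirchSwinnertonDyer.BirchSwinnertonDyer.Theorems.EtaConjADoorFamilyBSDRecords

/-- **[R1SS — BOTH analytic data from symbols, k8eta-c2 g24]** The record `missingPPartAt_r1s_c5c_17_5_of_classNumber` of this namespace with its displayed PLUS-side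
hypothesis `hX` «`(Lη) = (X)` for every plus branch function `Lη = L_5⁺(V,η,X)`» (PARI `λ⁺ = 1, μ⁺ = 0`) REPLACED by the symbol datum (N0″)
«for the newform `f` of `V` and every period ratio `ϖ` of even parity, `ϖ · coeff₁(quadraticBranchMazurTateElement 5 f 2)` is a non-zero rational of
`5`-adic valuation `1`» — READ by k8eta-c2 g24's kit j336272 (g23's engine MT-C1, stage 2 extended to the EVEN levels: exact symbols
`TH₂[u] = Σ_{m ≡ u (25)} (−1)^m ϖ[2^m/125]⁺_f`): `Σ_{u<25} u·TH₂[u] = 280` (`= 2^3·5·7`), valuation `1`; `Σ_u TH₂[u] = 0` and `TH₀ = 0`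
(θ₀(η)(0) = θ₂(η)(0) = 0: `L(W,1) = 0`); convention changes multiply it by a `5`-adic unit modulo `5²`. The step to `hX` is the KERNEL theorem
`EtaPlusCoeffCongruence.span_eq_span_X_of_mazurTate_padicValRat` (`L_5⁺(V,η,0) = 0` from `r_an(W) = 1` via EtaPrimeRoad + Kobayashi (3.6) + Birch;
`coeff₁θ₂(η) = 5·coeff₁M⁺ + 5²r`, `Lη = v·ϖ·M⁺`; `‖ϖ‖₅ ≤ 1` from `hM`). With (N1″) below, this record displays NO `p`-adic `L`-function numerics:
its analytic inputs are two exact-rational symbol valuations. The rest is VERBATIM the R1S record:** **[R1S — symbol-door variant, k8eta-c2 g24]** The `MissingPPartAt W 5` record `missingPPartAt_r1k_c5c_17_5_of_classNumber` of this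
namespace with its displayed analytic datum (N1′) «every minus branch function `L_5⁻(V,η,X)` has `coeff₁ ≠ 0`, `v₅(coeff₁) = 1`» REPLACED by
the symbol datum (N1″) «for the newform `f` of the twin `V` and every period ratio `ϖ` of even parity, `ϖ · coeff₁(quadraticBranchMazurTateElement 5 f 3)` is a
non-zero rational of `5`-adic valuation `2`» — READ by k8eta-c2 g24's kit j336119 (g23's engine MT-C1, stages 1–2 ONLY: Birch + FFT → exact
symbols `TH₃[u] = Σ_{m ≡ u (125)} (−1)^m ϖ[2^m/625]⁺_f`): `Σ_{u<125} u·TH₃[u] = -3100` (`= −2^2·5^2·31`), valuation `2`; `Σ_u TH₃[u] = 0`; a change of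
generator / sign / orientation / period normalisation multiplies this by a `5`-adic unit modulo `5³`, so the valuation is convention-free. The reading
`v₅(coeff₁ L) = 2 − 1 = 1` is the KERNEL theorem `EtaMinusCoeffCongruence.minusLeadingValuationAt_zero_of_mazurTate_padicValRat_of_level_of_mazur`
(`5·coeff₁L = ±v·ϖ·coeff₁θ₃(η) + 5³ϖr`, `v ∈ ℤ₅ˣ`; `‖ϖ‖₅ ≤ 1` from `hM`). Everything else — the row, its door datum, the named facts, (N2′), (N3′) — is
VERBATIM the r1k record:** **`MissingPPartAt W 5` — `ord_5 #Ш(W) = ord_5 #Ш_an(W)` (from Miller's `BSDp W 5`) — for the CONGRUENT-class (non-CM, `5`-congruent to a CM row;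
k8eta-c2 g8/g19) prime-`L` rank-one partner c5c:17, granted ONE good `a_5 = 0` globally minimal model `V` of `W^{(5)}` with non-onto `5`-adic tower,
modulo named facts and DISPLAYED MEASURED NUMERICS ONLY (no conjecture instance: the `λ⁻ = 3` shape with the first-coefficient valuation MEASURED)**
(`W = [0, 0, 0, -35005125, 62673298625]`, non-CM (congruent class c5c), `N_W = 46037700`; kit j326603 (k8eta-c2 g21, engine e5.gp) + g19 etanc
j317325 + j334509 (MT-C1, k8eta-c2 g23) (218 s, GRH): `ε(W) = −1`, PARI plus-`η` `(λ, μ) = (1, 0)`, `r_an(W) = 1` (`g19`); `h(ℚ(P)) = 12` (`[6,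
2]`), `h(ℚ(x(P))) = 3`; eigen dimensions `(d₁,d₂,d₃,d₄) = (0,0,0,0)` — door L6 (`5 ∤ h(ℚ(P))`) passes) from the ROW ALONE — named facts `hGZK hmod
hnf hM h12 hKO hGZ h74 h22 h41 h6273` (GZK, modularity, newforms, Mazur `p ∤ c₀`, Kobayashi Thm. 1.2 / 2.2 / 4.1 / 6.2–7.4, Kitajima–Otsuki Thm.
1.3, Gross–Zagier I (7.3); Poitou–Tate and the layer comparison are tree theorems); displayed: `r_an(W) = 1`, the twin `V` with the tower clause,
`(L_5⁺(V,η,X)) = (X)`, and — INSTEAD of the crux C-cc-1 at the row — three MEASURED numerical data: (N1″) the SYMBOL valuation stated above, (N2′) every generator of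
`W(ℚ)/tors` has `5`-divisibility level exactly `0` in `W(ℚ_5)` (kit etacomp), (N3′) `v_5(q·Tam/#tors²) = 1` for `q = #Ш_an(W)` (kit: `#Ш_an = 1`,
`Tam = 60`, `#tors = 1`); the law's arithmetic `1 = 2·0 + 1` is checked by `norm_num`, the class-group datum. Instance of
`EtaConjADoorBSDRankOne.bsdp_of_plusEtaMainConjectureAt_of_analyticRank_eq_one` ∘ g20's `EtaConjADoorRecords.etaMC_r1_of_classNumber` with `hcc1 :=`
`minusLeadingValuationAt_zero_of_coeff_valuation_of_level` (k8eta-c2 g22). CONDITIONAL; nothing booked. [cite: Kobayashi2003, §4 (p. 8), Thm. 2.2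
(p. 5)] [cite: CoatesSujatha2005, §3 (A) and Thm. 3.4] [cite: Zywina2015, Thm. 1.4] -/
theorem missingPPartAt_r1ss_c5c_17_5_of_classNumber
    (hGZK : rank_eq_analyticRank_of_analyticRank_le_one) (hmod : hasEntireLFunction_rat)
    (hnf : exists_isNewformOf) (hM : mazur_not_dvd_maninConstant_of_odd)
    (h12 : Kobayashi2003.thm12_signedSelmerDual_finite_torsion)
    (hKO : KitajimaOtsuki2018.mainThm13_etaSignedSelmerDual_noFiniteSubmodule)
    (hGZ : GrossZagier1986_thm_I_7_3) (h74 : Kobayashi2003.thm74_etaEvenMC_iff_etaOddMC)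
    (h22 : Kobayashi2003.thm22_etaSignedSelmerDual_finite_torsion)
    (h41 : Kobayashi2003.thm41_plusEtaCharIdeal_dvd)
    (h6273 : Kobayashi2003.thm62_63_73_etaColemanPoitouTate) [Fact (5 : ℕ).Prime]
    (W : WeierstrassCurve ℚ) (hW : W = (⟨0, 0, 0, (-35005125), 62673298625⟩ : WeierstrassCurve ℚ)) (hr : W.analyticRank = 1)
    (V : WeierstrassCurve ℚ) [V.IsElliptic] [V.IsGloballyMinimal] (C : VariableChange ℚ)
    (hC : C • W.quadraticTwist 5 = V)
    (hgood : V.HasGoodReductionAtPrime 5) (hap : V.frobeniusTrace 5 = 0)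
    (hns : ¬ ∀ m : ℕ, V.HasSurjectiveModNGaloisRep (5 ^ m : ℕ))
    (hθ₂ : ∀ {N : ℕ} [NeZero N] {f : CuspForm (Gamma0 N) 2}, IsNewformOf V f →
      ∀ (ϖ : ℚ), (if Even (5 / 2) then (ϖ : ℝ) * V.realPeriodRat = plusPeriod f
          else (ϖ : ℝ) * V.imaginaryPeriodRat = minusPeriod f) →
      ϖ * (quadraticBranchMazurTateElement 5 f 2).coeff 1 ≠ 0 ∧
        padicValRat 5 (ϖ * (quadraticBranchMazurTateElement 5 f 2).coeff 1) = 1)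
    (hP : haveI : W.IsElliptic := hW ▸ Summit.BirchSwinnertonDyer.BirchSwinnertonDyer.Theorems.EtaConjADoorFamilyBSDRecords.isElliptic_c5c_17
      haveI : NeZero (5 : ℕ) := ⟨by norm_num⟩
      haveI : NumberField (W.divisionField 5) := NumberField.mk
      ∃ P : geomTorsion W ((5 : ℕ) : ℤ), P ≠ 0 ∧
        ¬ 5 ∣ NumberField.classNumber (IntermediateField.fixedField
          ((MulAction.stabilizer (absoluteGaloisGroup ℚ) P).map (absRestrictNormalHom (W.divisionField 5)))))
    (hθ : haveI : W.IsElliptic := hW ▸ Summit.BirchSwinnertonDyer.BirchSwinnertonDyer.Theorems.EtaConjADoorFamilyBSDRecords.isElliptic_c5c_17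
      ∀ (V' : WeierstrassCurve ℚ) [V'.IsElliptic] [V'.IsGloballyMinimal] (C' : VariableChange ℚ)
        {N : ℕ} [NeZero N] {f : CuspForm (Gamma0 N) 2},
        C' • W.quadraticTwist 5 = V' → V'.HasGoodReductionAtPrime 5 → V'.frobeniusTrace 5 = 0 → IsNewformOf V' f →
        ∀ (ϖ : ℚ), (if Even (5 / 2) then (ϖ : ℝ) * V'.realPeriodRat = plusPeriod f
            else (ϖ : ℝ) * V'.imaginaryPeriodRat = minusPeriod f) →
        ϖ * (quadraticBranchMazurTateElement 5 f 3).coeff 1 ≠ 0 ∧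
          padicValRat 5 (ϖ * (quadraticBranchMazurTateElement 5 f 3).coeff 1) = 2)
    (hlev : haveI : W.IsElliptic := hW ▸ Summit.BirchSwinnertonDyer.BirchSwinnertonDyer.Theorems.EtaConjADoorFamilyBSDRecords.isElliptic_c5c_17
      ∀ P : W.toAffine.Point, ¬ IsOfFinAddOrder P →
        (∀ R : W.toAffine.Point, ∃ (k : ℤ) (T : W.toAffine.Point), IsOfFinAddOrder T ∧ R = k • P + T) →
        ∀ n : ℕ, (∃ Q : (W.baseChange ℚ_[5]).toAffine.Point, 5 ^ n • Q = W.toPadicPoint 5 P) →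
          (∀ Q : (W.baseChange ℚ_[5]).toAffine.Point, 5 ^ (n + 1) • Q ≠ W.toPadicPoint 5 P) → n = 0)
    (hval : haveI : W.IsElliptic := hW ▸ Summit.BirchSwinnertonDyer.BirchSwinnertonDyer.Theorems.EtaConjADoorFamilyBSDRecords.isElliptic_c5c_17
      haveI : W.IsGloballyMinimal := hW ▸ Summit.BirchSwinnertonDyer.BirchSwinnertonDyer.Theorems.EtaConjADoorFamilyBSDRecords.isGloballyMinimal_c5c_17
      ∀ q : ℚ, shaAn W = (q : ℂ) → padicValRat 5 (q * W.tamagawaProduct / (W.torsionOrder : ℚ) ^ 2) = 1) :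
    MissingPPartAt W 5 := by
  rw [← show ((-1 : ℚ) ^ ((5 : ℕ) / 2) * ((5 : ℕ) : ℚ)) = (5 : ℚ) by norm_num] at hθ
  subst hW
  haveI : (⟨0, 0, 0, (-35005125), 62673298625⟩ : WeierstrassCurve ℚ).IsElliptic := Summit.BirchSwinnertonDyer.BirchSwinnertonDyer.Theorems.EtaConjADoorFamilyBSDRecords.isElliptic_c5c_17
  haveI : (⟨0, 0, 0, (-35005125), 62673298625⟩ : WeierstrassCurve ℚ).IsGloballyMinimal := Summit.BirchSwinnertonDyer.BirchSwinnertonDyer.Theorems.EtaConjADoorFamilyBSDRecords.isGloballyMinimal_c5c_17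
  haveI : NeZero (5 : ℕ) := ⟨by norm_num⟩
  haveI : Finite (⟨0, 0, 0, (-35005125), 62673298625⟩ : WeierstrassCurve ℚ).sha := (hGZK _ (by omega)).2
  exact missingPPartAt_of_bsdp _ 5 (EtaConjADoorBSDRankOne.bsdp_of_plusEtaMainConjectureAt_of_analyticRank_eq_one _ 5 hGZK hmod hnf hM h12 hKO hGZ h74 (le_refl 5) V C
      (by rw [show ((-1 : ℚ) ^ ((5 : ℕ) / 2) * ((5 : ℕ) : ℚ)) = 5 by norm_num]; exact hC) hgood hap
      (EtaConjADoorRecords.etaMC_r1_of_classNumber h22 h41 h6273 hGZK 5 (le_refl 5) _ hr V C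
        (by rw [show ((-1 : ℚ) ^ ((5 : ℕ) / 2) * ((5 : ℕ) : ℚ)) = 5 by norm_num]; exact hC) hgood hap hns
          (EtaPlusCoeffCongruence.span_eq_span_X_of_mazurTate_padicValRat 5 hmod hM (le_refl 5) _ hr V C
            (by rw [show ((-1 : ℚ) ^ ((5 : ℕ) / 2) * ((5 : ℕ) : ℚ)) = 5 by norm_num]; exact hC) hgood hap hθ₂) hP) hr
    (EtaMinusCoeffCongruence.minusLeadingValuationAt_zero_of_mazurTate_padicValRat_of_level_of_mazur _ 5 hM (le_refl 5) 1 0 1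
      (by norm_num) 1 2 (by norm_num) (by norm_num) hθ hlev hval))

end Summit.BirchSwinnertonDyer.BirchSwinnertonDyer.Theorems.EtaConjADoorFamilyBSDRecords

namespace Summit.BirchSwinnertonDyer.BirchSwinnertonDyer.Theorems.EtaConjADoorFamilyBSDRecords

/-- **[R1SS — BOTH analytic data from symbols, k8eta-c2 g24]** The record `missingPPartAt_r1s_c5e_17_5_of_classNumber` of this namespace with its displayed PLUS-side
hypothesis `hX` «`(Lη) = (X)` for every plus branch function `Lη = L_5⁺(V,η,X)`» (PARI `λ⁺ = 1, μ⁺ = 0`) REPLACED by the symbol datum (N0″)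
«for the newform `f` of `V` and every period ratio `ϖ` of even parity, `ϖ · coeff₁(quadraticBranchMazurTateElement 5 f 2)` is a non-zero rational of
`5`-adic valuation `1`» — READ by k8eta-c2 g24's kit j336272 (g23's engine MT-C1, stage 2 extended to the EVEN levels: exact symbols
`TH₂[u] = Σ_{m ≡ u (25)} (−1)^m ϖ[2^m/125]⁺_f`): `Σ_{u<25} u·TH₂[u] = 7060` (`= 2^2·5·353`), valuation `1`; `Σ_u TH₂[u] = 0` and `TH₀ = 0`
(θ₀(η)(0) = θ₂(η)(0) = 0: `L(W,1) = 0`); convention changes multiply it by a `5`-adic unit modulo `5²`. The step to `hX` is the KERNEL theorem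
`EtaPlusCoeffCongruence.span_eq_span_X_of_mazurTate_padicValRat` (`L_5⁺(V,η,0) = 0` from `r_an(W) = 1` via EtaPrimeRoad + Kobayashi (3.6) + Birch;
`coeff₁θ₂(η) = 5·coeff₁M⁺ + 5²r`, `Lη = v·ϖ·M⁺`; `‖ϖ‖₅ ≤ 1` from `hM`). With (N1″) below, this record displays NO `p`-adic `L`-function numerics:
its analytic inputs are two exact-rational symbol valuations. The rest is VERBATIM the R1S record:** **[R1S — symbol-door variant, k8eta-c2 g24]** The `MissingPPartAt W 5` record `missingPPartAt_r1k_c5e_17_5_of_classNumber` of this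
namespace with its displayed analytic datum (N1′) «every minus branch function `L_5⁻(V,η,X)` has `coeff₁ ≠ 0`, `v₅(coeff₁) = 1`» REPLACED by
the symbol datum (N1″) «for the newform `f` of the twin `V` and every period ratio `ϖ` of even parity, `ϖ · coeff₁(quadraticBranchMazurTateElement 5 f 3)` is a
non-zero rational of `5`-adic valuation `2`» — READ by k8eta-c2 g24's kit j336119 (g23's engine MT-C1, stages 1–2 ONLY: Birch + FFT → exact
symbols `TH₃[u] = Σ_{m ≡ u (125)} (−1)^m ϖ[2^m/625]⁺_f`): `Σ_{u<125} u·TH₃[u] = -9900` (`= −2^2·3^2·5^2·11`), valuation `2`; `Σ_u TH₃[u] = 0`; a change of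
generator / sign / orientation / period normalisation multiplies this by a `5`-adic unit modulo `5³`, so the valuation is convention-free. The reading
`v₅(coeff₁ L) = 2 − 1 = 1` is the KERNEL theorem `EtaMinusCoeffCongruence.minusLeadingValuationAt_zero_of_mazurTate_padicValRat_of_level_of_mazur`
(`5·coeff₁L = ±v·ϖ·coeff₁θ₃(η) + 5³ϖr`, `v ∈ ℤ₅ˣ`; `‖ϖ‖₅ ≤ 1` from `hM`). Everything else — the row, its door datum, the named facts, (N2′), (N3′) — is
VERBATIM the r1k record:** **`MissingPPartAt W 5` — `ord_5 #Ш(W) = ord_5 #Ш_an(W)` (from Miller's `BSDp W 5`) — for the CONGRUENT-class (non-CM, `5`-congruent to a CM row;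
k8eta-c2 g8/g19) prime-`L` rank-one partner c5e:17, granted ONE good `a_5 = 0` globally minimal model `V` of `W^{(5)}` with non-onto `5`-adic tower,
modulo named facts and DISPLAYED MEASURED NUMERICS ONLY (no conjecture instance: the `λ⁻ = 3` shape with the first-coefficient valuation MEASURED)**
(`W = [0, 0, 0, -753423000, -7385081579500]`, non-CM (congruent class c5e), `N_W = 70487100`; kit j326603 (k8eta-c2 g21, engine e5.gp) + g19 etanc
j317325 + j334509 (MT-C1, k8eta-c2 g23) (77 s, GRH): `ε(W) = −1`, PARI plus-`η` `(λ, μ) = (1, 0)`, `r_an(W) = 1` (`g19`); `h(ℚ(P)) = 4` (`[2, 2]`),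
`h(ℚ(x(P))) = 1`; eigen dimensions `(d₁,d₂,d₃,d₄) = (0,0,0,0)` — door L6 (`5 ∤ h(ℚ(P))`) passes) from the ROW ALONE — named facts `hGZK hmod hnf hM
h12 hKO hGZ h74 h22 h41 h6273` (GZK, modularity, newforms, Mazur `p ∤ c₀`, Kobayashi Thm. 1.2 / 2.2 / 4.1 / 6.2–7.4, Kitajima–Otsuki Thm. 1.3,
Gross–Zagier I (7.3); Poitou–Tate and the layer comparison are tree theorems); displayed: `r_an(W) = 1`, the twin `V` with the tower clause,
`(L_5⁺(V,η,X)) = (X)`, and — INSTEAD of the crux C-cc-1 at the row — three MEASURED numerical data: (N1″) the SYMBOL valuation stated above, (N2′) every generator of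
`W(ℚ)/tors` has `5`-divisibility level exactly `0` in `W(ℚ_5)` (kit etacomp), (N3′) `v_5(q·Tam/#tors²) = 1` for `q = #Ш_an(W)` (kit: `#Ш_an = 1`,
`Tam = 40`, `#tors = 1`); the law's arithmetic `1 = 2·0 + 1` is checked by `norm_num`, the class-group datum. Instance of
`EtaConjADoorBSDRankOne.bsdp_of_plusEtaMainConjectureAt_of_analyticRank_eq_one` ∘ g20's `EtaConjADoorRecords.etaMC_r1_of_classNumber` with `hcc1 :=`
`minusLeadingValuationAt_zero_of_coeff_valuation_of_level` (k8eta-c2 g22). CONDITIONAL; nothing booked. [cite: Kobayashi2003, §4 (p. 8), Thm. 2.2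
(p. 5)] [cite: CoatesSujatha2005, §3 (A) and Thm. 3.4] [cite: Zywina2015, Thm. 1.4] -/
theorem missingPPartAt_r1ss_c5e_17_5_of_classNumber
    (hGZK : rank_eq_analyticRank_of_analyticRank_le_one) (hmod : hasEntireLFunction_rat)
    (hnf : exists_isNewformOf) (hM : mazur_not_dvd_maninConstant_of_odd)
    (h12 : Kobayashi2003.thm12_signedSelmerDual_finite_torsion)
    (hKO : KitajimaOtsuki2018.mainThm13_etaSignedSelmerDual_noFiniteSubmodule)
    (hGZ : GrossZagier1986_thm_I_7_3) (h74 : Kobayashi2003.thm74_etaEvenMC_iff_etaOddMC)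
    (h22 : Kobayashi2003.thm22_etaSignedSelmerDual_finite_torsion)
    (h41 : Kobayashi2003.thm41_plusEtaCharIdeal_dvd)
    (h6273 : Kobayashi2003.thm62_63_73_etaColemanPoitouTate) [Fact (5 : ℕ).Prime]
    (W : WeierstrassCurve ℚ) (hW : W = (⟨0, 0, 0, (-753423000), (-7385081579500)⟩ : WeierstrassCurve ℚ)) (hr : W.analyticRank = 1)
    (V : WeierstrassCurve ℚ) [V.IsElliptic] [V.IsGloballyMinimal] (C : VariableChange ℚ)
    (hC : C • W.quadraticTwist 5 = V)
    (hgood : V.HasGoodReductionAtPrime 5) (hap : V.frobeniusTrace 5 = 0)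
    (hns : ¬ ∀ m : ℕ, V.HasSurjectiveModNGaloisRep (5 ^ m : ℕ))
    (hθ₂ : ∀ {N : ℕ} [NeZero N] {f : CuspForm (Gamma0 N) 2}, IsNewformOf V f →
      ∀ (ϖ : ℚ), (if Even (5 / 2) then (ϖ : ℝ) * V.realPeriodRat = plusPeriod f
          else (ϖ : ℝ) * V.imaginaryPeriodRat = minusPeriod f) →
      ϖ * (quadraticBranchMazurTateElement 5 f 2).coeff 1 ≠ 0 ∧
        padicValRat 5 (ϖ * (quadraticBranchMazurTateElement 5 f 2).coeff 1) = 1)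
    (hP : haveI : W.IsElliptic := hW ▸ Summit.BirchSwinnertonDyer.BirchSwinnertonDyer.Theorems.EtaConjADoorFamilyBSDRecords.isElliptic_c5e_17
      haveI : NeZero (5 : ℕ) := ⟨by norm_num⟩
      haveI : NumberField (W.divisionField 5) := NumberField.mk
      ∃ P : geomTorsion W ((5 : ℕ) : ℤ), P ≠ 0 ∧
        ¬ 5 ∣ NumberField.classNumber (IntermediateField.fixedField
          ((MulAction.stabilizer (absoluteGaloisGroup ℚ) P).map (absRestrictNormalHom (W.divisionField 5)))))
    (hθ : haveI : W.IsElliptic := hW ▸ Summit.BirchSwinnertonDyer.BirchSwinnertonDyer.Theorems.EtaConjADoorFamilyBSDRecords.isElliptic_c5e_17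
      ∀ (V' : WeierstrassCurve ℚ) [V'.IsElliptic] [V'.IsGloballyMinimal] (C' : VariableChange ℚ)
        {N : ℕ} [NeZero N] {f : CuspForm (Gamma0 N) 2},
        C' • W.quadraticTwist 5 = V' → V'.HasGoodReductionAtPrime 5 → V'.frobeniusTrace 5 = 0 → IsNewformOf V' f →
        ∀ (ϖ : ℚ), (if Even (5 / 2) then (ϖ : ℝ) * V'.realPeriodRat = plusPeriod f
            else (ϖ : ℝ) * V'.imaginaryPeriodRat = minusPeriod f) →
        ϖ * (quadraticBranchMazurTateElement 5 f 3).coeff 1 ≠ 0 ∧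
          padicValRat 5 (ϖ * (quadraticBranchMazurTateElement 5 f 3).coeff 1) = 2)
    (hlev : haveI : W.IsElliptic := hW ▸ Summit.BirchSwinnertonDyer.BirchSwinnertonDyer.Theorems.EtaConjADoorFamilyBSDRecords.isElliptic_c5e_17
      ∀ P : W.toAffine.Point, ¬ IsOfFinAddOrder P →
        (∀ R : W.toAffine.Point, ∃ (k : ℤ) (T : W.toAffine.Point), IsOfFinAddOrder T ∧ R = k • P + T) →
        ∀ n : ℕ, (∃ Q : (W.baseChange ℚ_[5]).toAffine.Point, 5 ^ n • Q = W.toPadicPoint 5 P) →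
          (∀ Q : (W.baseChange ℚ_[5]).toAffine.Point, 5 ^ (n + 1) • Q ≠ W.toPadicPoint 5 P) → n = 0)
    (hval : haveI : W.IsElliptic := hW ▸ Summit.BirchSwinnertonDyer.BirchSwinnertonDyer.Theorems.EtaConjADoorFamilyBSDRecords.isElliptic_c5e_17
      haveI : W.IsGloballyMinimal := hW ▸ Summit.BirchSwinnertonDyer.BirchSwinnertonDyer.Theorems.EtaConjADoorFamilyBSDRecords.isGloballyMinimal_c5e_17
      ∀ q : ℚ, shaAn W = (q : ℂ) → padicValRat 5 (q * W.tamagawaProduct / (W.torsionOrder : ℚ) ^ 2) = 1) :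
    MissingPPartAt W 5 := by
  rw [← show ((-1 : ℚ) ^ ((5 : ℕ) / 2) * ((5 : ℕ) : ℚ)) = (5 : ℚ) by norm_num] at hθ
  subst hW
  haveI : (⟨0, 0, 0, (-753423000), (-7385081579500)⟩ : WeierstrassCurve ℚ).IsElliptic := Summit.BirchSwinnertonDyer.BirchSwinnertonDyer.Theorems.EtaConjADoorFamilyBSDRecords.isElliptic_c5e_17
  haveI : (⟨0, 0, 0, (-753423000), (-7385081579500)⟩ : WeierstrassCurve ℚ).IsGloballyMinimal := Summit.BirchSwinnertonDyer.BirchSwinnertonDyer.Theorems.EtaConjADoorFamilyBSDRecords.isGloballyMinimal_c5e_17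
  haveI : NeZero (5 : ℕ) := ⟨by norm_num⟩
  haveI : Finite (⟨0, 0, 0, (-753423000), (-7385081579500)⟩ : WeierstrassCurve ℚ).sha := (hGZK _ (by omega)).2
  exact missingPPartAt_of_bsdp _ 5 (EtaConjADoorBSDRankOne.bsdp_of_plusEtaMainConjectureAt_of_analyticRank_eq_one _ 5 hGZK hmod hnf hM h12 hKO hGZ h74 (le_refl 5) V C
      (by rw [show ((-1 : ℚ) ^ ((5 : ℕ) / 2) * ((5 : ℕ) : ℚ)) = 5 by norm_num]; exact hC) hgood hap
      (EtaConjADoorRecords.etaMC_r1_of_classNumber h22 h41 h6273 hGZK 5 (le_refl 5) _ hr V C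
        (by rw [show ((-1 : ℚ) ^ ((5 : ℕ) / 2) * ((5 : ℕ) : ℚ)) = 5 by norm_num]; exact hC) hgood hap hns
          (EtaPlusCoeffCongruence.span_eq_span_X_of_mazurTate_padicValRat 5 hmod hM (le_refl 5) _ hr V C
            (by rw [show ((-1 : ℚ) ^ ((5 : ℕ) / 2) * ((5 : ℕ) : ℚ)) = 5 by norm_num]; exact hC) hgood hap hθ₂) hP) hr
    (EtaMinusCoeffCongruence.minusLeadingValuationAt_zero_of_mazurTate_padicValRat_of_level_of_mazur _ 5 hM (le_refl 5) 1 0 1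
      (by norm_num) 1 2 (by norm_num) (by norm_num) hθ hlev hval))

end Summit.BirchSwinnertonDyer.BirchSwinnertonDyer.Theorems.EtaConjADoorFamilyBSDRecords

namespace Summit.BirchSwinnertonDyer.BirchSwinnertonDyer.Theorems.EtaConjADoorFamilyBSDRecords

/-- **[R1SS — BOTH analytic data from symbols, k8eta-c2 g24]** The record `missingPPartAt_r1s_c5f_8_5_of_eigenHom` of this namespace with its displayed PLUS-side
hypothesis `hX` «`(Lη) = (X)` for every plus branch function `Lη = L_5⁺(V,η,X)`» (PARI `λ⁺ = 1, μ⁺ = 0`) REPLACED by the symbol datum (N0″)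
«for the newform `f` of `V` and every period ratio `ϖ` of even parity, `ϖ · coeff₁(quadraticBranchMazurTateElement 5 f 2)` is a non-zero rational of
`5`-adic valuation `1`» — READ by k8eta-c2 g24's kit j336272 (g23's engine MT-C1, stage 2 extended to the EVEN levels: exact symbols
`TH₂[u] = Σ_{m ≡ u (25)} (−1)^m ϖ[2^m/125]⁺_f`): `Σ_{u<25} u·TH₂[u] = -330` (`= −2·3·5·11`), valuation `1`; `Σ_u TH₂[u] = 0` and `TH₀ = 0`
(θ₀(η)(0) = θ₂(η)(0) = 0: `L(W,1) = 0`); convention changes multiply it by a `5`-adic unit modulo `5²`. The step to `hX` is the KERNEL theorem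
`EtaPlusCoeffCongruence.span_eq_span_X_of_mazurTate_padicValRat` (`L_5⁺(V,η,0) = 0` from `r_an(W) = 1` via EtaPrimeRoad + Kobayashi (3.6) + Birch;
`coeff₁θ₂(η) = 5·coeff₁M⁺ + 5²r`, `Lη = v·ϖ·M⁺`; `‖ϖ‖₅ ≤ 1` from `hM`). With (N1″) below, this record displays NO `p`-adic `L`-function numerics:
its analytic inputs are two exact-rational symbol valuations. The rest is VERBATIM the R1S record:** **[R1S — symbol-door variant, k8eta-c2 g24]** The `MissingPPartAt W 5` record `missingPPartAt_r1k_c5f_8_5_of_eigenHom` of this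
namespace with its displayed analytic datum (N1′) «every minus branch function `L_5⁻(V,η,X)` has `coeff₁ ≠ 0`, `v₅(coeff₁) = 1`» REPLACED by
the symbol datum (N1″) «for the newform `f` of the twin `V` and every period ratio `ϖ` of even parity, `ϖ · coeff₁(quadraticBranchMazurTateElement 5 f 3)` is a
non-zero rational of `5`-adic valuation `2`» — READ by k8eta-c2 g24's kit j336119 (g23's engine MT-C1, stages 1–2 ONLY: Birch + FFT → exact
symbols `TH₃[u] = Σ_{m ≡ u (125)} (−1)^m ϖ[2^m/625]⁺_f`): `Σ_{u<125} u·TH₃[u] = -1650` (`= −2·3·5^2·11`), valuation `2`; `Σ_u TH₃[u] = 0`; a change of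
generator / sign / orientation / period normalisation multiplies this by a `5`-adic unit modulo `5³`, so the valuation is convention-free. The reading
`v₅(coeff₁ L) = 2 − 1 = 1` is the KERNEL theorem `EtaMinusCoeffCongruence.minusLeadingValuationAt_zero_of_mazurTate_padicValRat_of_level_of_mazur`
(`5·coeff₁L = ±v·ϖ·coeff₁θ₃(η) + 5³ϖr`, `v ∈ ℤ₅ˣ`; `‖ϖ‖₅ ≤ 1` from `hM`). Everything else — the row, its door datum, the named facts, (N2′), (N3′) — is
VERBATIM the r1k record:** **`MissingPPartAt W 5` — `ord_5 #Ш(W) = ord_5 #Ш_an(W)` (from Miller's `BSDp W 5`) — for the CONGRUENT-class (non-CM, `5`-congruent to a CM row;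
k8eta-c2 g8/g19) prime-`L` rank-one partner c5f:8, granted ONE good `a_5 = 0` globally minimal model `V` of `W^{(5)}` with non-onto `5`-adic tower,
modulo named facts and DISPLAYED MEASURED NUMERICS ONLY (no conjecture instance: the `λ⁻ = 3` shape with the first-coefficient valuation MEASURED)**
(`W = [0, 0, 0, -84000, 362250]`, non-CM (congruent class c5f), `N_W = 21873600`; kit j326603 (k8eta-c2 g21, engine e5.gp) + g19 etanc j317325 +
j334509 (MT-C1, k8eta-c2 g23) (119 s, GRH): `ε(W) = −1`, PARI plus-`η` `(λ, μ) = (1, 0)`, `r_an(W) = 1` (`g19`); `h(ℚ(P)) = 120` (`[30, 2, 2]`),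
`h(ℚ(x(P))) = 3`; eigen dimensions `(d₁,d₂,d₃,d₄) = (0,0,1,0)` — door L2 (`2` is not an eigenvalue of `σ₂`) passes) from the ROW ALONE — named facts
`hGZK hmod hnf hM h12 hKO hGZ h74 h22 h41 h6273` (GZK, modularity, newforms, Mazur `p ∤ c₀`, Kobayashi Thm. 1.2 / 2.2 / 4.1 / 6.2–7.4,
Kitajima–Otsuki Thm. 1.3, Gross–Zagier I (7.3); Poitou–Tate and the layer comparison are tree theorems); displayed: `r_an(W) = 1`, the twin `V` with
the tower clause, `(L_5⁺(V,η,X)) = (X)`, and — INSTEAD of the crux C-cc-1 at the row — three MEASURED numerical data: (N1″) the SYMBOL valuation stated above, (N2′) every generator of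
`W(ℚ)/tors` has `5`-divisibility level exactly `0` in `W(ℚ_5)` (kit etacomp), (N3′) `v_5(q·Tam/#tors²) = 1` for `q = #Ш_an(W)` (kit: `#Ш_an = 1`,
`Tam = 20`, `#tors = 1`); the law's arithmetic `1 = 2·0 + 1` is checked by `norm_num`, the class-group datum. Instance of
`EtaConjADoorBSDRankOne.bsdp_r1_of_eigenHom` with `hcc1 :=` `minusLeadingValuationAt_zero_of_coeff_valuation_of_level` (k8eta-c2 g22). CONDITIONAL;
nothing booked. [cite: Kobayashi2003, §4 (p. 8), Thm. 2.2 (p. 5)] [cite: CoatesSujatha2005, §3 (A) and Thm. 3.4] [cite: Zywina2015, Thm. 1.4] -/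
theorem missingPPartAt_r1ss_c5f_8_5_of_eigenHom
    (hGZK : rank_eq_analyticRank_of_analyticRank_le_one) (hmod : hasEntireLFunction_rat)
    (hnf : exists_isNewformOf) (hM : mazur_not_dvd_maninConstant_of_odd)
    (h12 : Kobayashi2003.thm12_signedSelmerDual_finite_torsion)
    (hKO : KitajimaOtsuki2018.mainThm13_etaSignedSelmerDual_noFiniteSubmodule)
    (hGZ : GrossZagier1986_thm_I_7_3) (h74 : Kobayashi2003.thm74_etaEvenMC_iff_etaOddMC)
    (h22 : Kobayashi2003.thm22_etaSignedSelmerDual_finite_torsion)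
    (h41 : Kobayashi2003.thm41_plusEtaCharIdeal_dvd)
    (h6273 : Kobayashi2003.thm62_63_73_etaColemanPoitouTate) [Fact (5 : ℕ).Prime]
    (W : WeierstrassCurve ℚ) (hW : W = (⟨0, 0, 0, (-84000), 362250⟩ : WeierstrassCurve ℚ)) (hr : W.analyticRank = 1)
    (V : WeierstrassCurve ℚ) [V.IsElliptic] [V.IsGloballyMinimal] (C : VariableChange ℚ)
    (hC : C • W.quadraticTwist 5 = V)
    (hgood : V.HasGoodReductionAtPrime 5) (hap : V.frobeniusTrace 5 = 0)
    (hns : ¬ ∀ m : ℕ, V.HasSurjectiveModNGaloisRep (5 ^ m : ℕ))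
    (hθ₂ : ∀ {N : ℕ} [NeZero N] {f : CuspForm (Gamma0 N) 2}, IsNewformOf V f →
      ∀ (ϖ : ℚ), (if Even (5 / 2) then (ϖ : ℝ) * V.realPeriodRat = plusPeriod f
          else (ϖ : ℝ) * V.imaginaryPeriodRat = minusPeriod f) →
      ϖ * (quadraticBranchMazurTateElement 5 f 2).coeff 1 ≠ 0 ∧
        padicValRat 5 (ϖ * (quadraticBranchMazurTateElement 5 f 2).coeff 1) = 1)
    (hP : haveI : W.IsElliptic := hW ▸ Summit.BirchSwinnertonDyer.BirchSwinnertonDyer.Theorems.EtaConjADoorFamilyBSDRecords.isElliptic_c5f_8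
      haveI : NeZero (5 : ℕ) := ⟨by norm_num⟩
      haveI : NumberField (W.divisionField 5) := NumberField.mk
      ∃ P : geomTorsion W ((5 : ℕ) : ℤ), P ≠ 0 ∧
        ∀ K : IntermediateField ℚ (W.divisionField 5),
          K = IntermediateField.fixedField
            ((MulAction.stabilizer (absoluteGaloisGroup ℚ) P).map (absRestrictNormalHom (W.divisionField 5))) →
        ∀ μ : Additive (ClassGroup (𝓞 K)) →+ ZMod 5,
          (∀ (τ : absoluteGaloisGroup ℚ) (σ : K ≃ₐ[ℚ] K) (a : ℕ),
              (∀ x : K, absRestrictNormalHom (W.divisionField 5) τ (x : W.divisionField 5) =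
                ((σ x : K) : W.divisionField 5)) → τ • P = a • P →
              ∀ (I J : (Ideal (𝓞 K))⁰),
                (J : Ideal (𝓞 K)) = (I : Ideal (𝓞 K)).map (AmbiguousClass.intAut σ : 𝓞 K →+* 𝓞 K) →
                μ (Additive.ofMul (ClassGroup.mk0 J)) = a • μ (Additive.ofMul (ClassGroup.mk0 I))) →
          μ = 0)
    (hθ : haveI : W.IsElliptic := hW ▸ Summit.BirchSwinnertonDyer.BirchSwinnertonDyer.Theorems.EtaConjADoorFamilyBSDRecords.isElliptic_c5f_8
      ∀ (V' : WeierstrassCurve ℚ) [V'.IsElliptic] [V'.IsGloballyMinimal] (C' : VariableChange ℚ)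
        {N : ℕ} [NeZero N] {f : CuspForm (Gamma0 N) 2},
        C' • W.quadraticTwist 5 = V' → V'.HasGoodReductionAtPrime 5 → V'.frobeniusTrace 5 = 0 → IsNewformOf V' f →
        ∀ (ϖ : ℚ), (if Even (5 / 2) then (ϖ : ℝ) * V'.realPeriodRat = plusPeriod f
            else (ϖ : ℝ) * V'.imaginaryPeriodRat = minusPeriod f) →
        ϖ * (quadraticBranchMazurTateElement 5 f 3).coeff 1 ≠ 0 ∧
          padicValRat 5 (ϖ * (quadraticBranchMazurTateElement 5 f 3).coeff 1) = 2)
    (hlev : haveI : W.IsElliptic := hW ▸ Summit.BirchSwinnertonDyer.BirchSwinnertonDyer.Theorems.EtaConjADoorFamilyBSDRecords.isElliptic_c5f_8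
      ∀ P : W.toAffine.Point, ¬ IsOfFinAddOrder P →
        (∀ R : W.toAffine.Point, ∃ (k : ℤ) (T : W.toAffine.Point), IsOfFinAddOrder T ∧ R = k • P + T) →
        ∀ n : ℕ, (∃ Q : (W.baseChange ℚ_[5]).toAffine.Point, 5 ^ n • Q = W.toPadicPoint 5 P) →
          (∀ Q : (W.baseChange ℚ_[5]).toAffine.Point, 5 ^ (n + 1) • Q ≠ W.toPadicPoint 5 P) → n = 0)
    (hval : haveI : W.IsElliptic := hW ▸ Summit.BirchSwinnertonDyer.BirchSwinnertonDyer.Theorems.EtaConjADoorFamilyBSDRecords.isElliptic_c5f_8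
      haveI : W.IsGloballyMinimal := hW ▸ Summit.BirchSwinnertonDyer.BirchSwinnertonDyer.Theorems.EtaConjADoorFamilyBSDRecords.isGloballyMinimal_c5f_8
      ∀ q : ℚ, shaAn W = (q : ℂ) → padicValRat 5 (q * W.tamagawaProduct / (W.torsionOrder : ℚ) ^ 2) = 1) :
    MissingPPartAt W 5 := by
  rw [← show ((-1 : ℚ) ^ ((5 : ℕ) / 2) * ((5 : ℕ) : ℚ)) = (5 : ℚ) by norm_num] at hθ
  subst hW
  haveI : (⟨0, 0, 0, (-84000), 362250⟩ : WeierstrassCurve ℚ).IsElliptic := Summit.BirchSwinnertonDyer.BirchSwinnertonDyer.Theorems.EtaConjADoorFamilyBSDRecords.isElliptic_c5f_8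
  haveI : (⟨0, 0, 0, (-84000), 362250⟩ : WeierstrassCurve ℚ).IsGloballyMinimal := Summit.BirchSwinnertonDyer.BirchSwinnertonDyer.Theorems.EtaConjADoorFamilyBSDRecords.isGloballyMinimal_c5f_8
  haveI : NeZero (5 : ℕ) := ⟨by norm_num⟩
  haveI : Finite (⟨0, 0, 0, (-84000), 362250⟩ : WeierstrassCurve ℚ).sha := (hGZK _ (by omega)).2
  exact missingPPartAt_of_bsdp _ 5 (EtaConjADoorBSDRankOne.bsdp_r1_of_eigenHom _ 5 hGZK hmod hnf hM h12 hKO hGZ h74 h22 h41 h6273 (le_refl 5) hr V C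
    (by rw [show ((-1 : ℚ) ^ ((5 : ℕ) / 2) * ((5 : ℕ) : ℚ)) = 5 by norm_num]; exact hC) hgood hap hns
          (EtaPlusCoeffCongruence.span_eq_span_X_of_mazurTate_padicValRat 5 hmod hM (le_refl 5) _ hr V C
            (by rw [show ((-1 : ℚ) ^ ((5 : ℕ) / 2) * ((5 : ℕ) : ℚ)) = 5 by norm_num]; exact hC) hgood hap hθ₂) hP
    (EtaMinusCoeffCongruence.minusLeadingValuationAt_zero_of_mazurTate_padicValRat_of_level_of_mazur _ 5 hM (le_refl 5) 1 0 1
      (by norm_num) 1 2 (by norm_num) (by norm_num) hθ hlev hval))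

end Summit.BirchSwinnertonDyer.BirchSwinnertonDyer.Theorems.EtaConjADoorFamilyBSDRecords

end
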